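import Summits.HodgeConjecture.HodgeConjecture.Theorems.F0P5CurveThetaCompanionRelabelOfLocalFactors
import Literature.NumberTheory.Automorphic.Liu2021.Def411WeilCarriersAtChiSplittingGluingCM
import Literature.NumberTheory.Automorphic.Liu2021.LemD1RankTwoCMLetters
import HarnessLib

/-!
# Crux `HLiu418`, line `F0_P5_CurveThetaLettersPaydown` — stub **R2′** `CompanionRelabelTransfer₂` modulo ONE letter: the «IF» HALF of
# [Liu2021, Lem. D.1 (4)] at the NON-SPLIT places (the `L4-if` CUT + the `L1` ELIMINATION; the binder BY NAME on ★ `LemD1RankTwoCMLetters`)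

Cell hodgecm-mathlib (D-0151), FLOOR 0, P5 (Alb-CM), crux `HLiu418` = stmt-HodgeConjecture-24832; pay-down line
`Cruxes/HLiu418/Lines/F0_P5_CurveThetaLettersPaydown.lean` (ED. 6), stub R2′ `stub_sl_companionRelabelTransfer : CompanionRelabelTransfer₂`.  Third sibling of
★ `F0P5CurveThetaCompanionRelabelOfLocalFactors` (p830748) ∕ ★ `…OfNonsplitLetters` (p830977); seat A-p17 (g18); rows «L4-if» + «L1 ELIMINATION» (F0P5-plan (g4)
2026-08-31T19:03:44Z ∕ 19:17:49Z).  THEOREMS ONLY; `--supports stmt-HodgeConjecture-24832 --as helper`.  HONEST LABEL: HC_CM is proved only modulo the printed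
citations — the 2 remaining named inputs (hLiu418, h413) — until rung 0 closes; this file retires no printed statement by itself: it closes R2′ modulo ONE
letter, ★ `LemD1RankTwoCMLetters.LemD1_4IfAsPrintedNonsplitCM₂` = [Liu2021, Lem. D.1 (4)] «IF» direction, SECOND alternative («`n = 2`, `ω(μ,ε,χ) ≠ 0`,
`μ′ = μᶜχ̌`, `χ′ = χ`, (`V` isotropic → `ε′ ~ ε`), (`V` anisotropic → `ε′ ≁ ε`) ⇒ `ω(μ′,ε′,χ′) ≅ ω(μ,ε,χ)`»), READING I3 on the two members `(λ, a, χ)`,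
`(λ′, a′, χ)` of the θ-package family (CM packages) at the finite places of `L⁺` NON-SPLIT in `L` — the rank-one theta dichotomy content
[HarrisKudlaSweet1996, Thm. 6.1]; taken BY NAME (zero δ-risk for the registrar's fold).  The companion-package letter `L1` ([Liu2021, Lem. D.1 (1)]) is
ELIMINATED: Flath's a.e. line clause needs only its FIRST SENTENCE (irreducible-or-zero + admissible), in-house at every place — ★ A-p18 (g22)
`exists_equiv_rhoVAtLine_of_forall_areIsomorphicRep_localFactor_cm` over ★ B-typ04 (g18) `isIrreducibleOrZero_and_isAdmissible_localLemD1DataAtV₂_of_isField`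
(non-split, MVW IV.4 ★) and ★ B-p04 (g30) `lemD1_1AsPrinted_localLemD1DataAtV₂_of_not_isField` (split model ★).

PROOF = ★ p830748's assembly with (i) the non-split member-wise isomorphism read off the «if» predicate ★ `LemD1_4IfAsPrintedI` through ★ (r1)
`areIsomorphicRep_localType₂_iff_quot` ∕ `nontrivial_localType₂_iff_quot` (§1 `areIsomorphicRep_localFactor_companion_of_lemD1_4IfAsPrintedI`: ★ R2′-J
`muOf_localMu_eq_muTwist`, ★ `localCharOfCenter_theta_eq`, ★ L1 `sameClass_epsLine_iff_locF_apply_eq`), (ii) the split member-wise isomorphism ★ B-p08 (g22)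
`areIsomorphicRep_localFactor_comp_localLineInl_of_split` fed by ★ `localComponent_companion_eq`, (iii) the gluing ★ (E2) above (no letter), (iv) `j′ := Ψ ∘ j`.
§2 head **`companionRelabelTransfer₂_of_nonsplit_if_letter (h4if)`** = the registered signature of `CompanionRelabelTransfer₂` UNFOLDED verbatim; ED. 7 fold:
`theorem stub_sl_companionRelabelTransfer : CompanionRelabelTransfer₂ :=
F0P5CurveThetaCompanionRelabelOfNonsplitIfLetter.companionRelabelTransfer₂_of_nonsplit_if_letter stub_letter_lemD14_if_nonsplit`.

## References
* [Liu2021] Y. Liu, *Fourier–Jacobi cycles and arithmetic relative trace formula*, Camb. J. Math. 9 (2021) = arXiv:2102.11518: App. D §D.1 Steps 1–3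
  (l. 5213–5224), Lem. D.1 (1) (l. 5227–5229), (4) (l. 5235, p. 126) and its proof (l. 5241–5262); Rem. 4.4.
* [HarrisKudlaSweet1996] M. Harris, S. Kudla, W. J. Sweet, *Theta dichotomy for unitary groups*, J. AMS 9 (1996), Thm. 6.1.
* [Flath1979] D. Flath, *Decomposition of representations into tensor products*, Proc. Sympos. Pure Math. 33 (1979), part 1, §2 Example 2.
-/

set_option autoImplicit false

-- the mandated namespace has the single-problem summit's repeated segment (`HodgeConjecture.HodgeConjecture`)
set_option linter.dupNamespace false

noncomputable section

open scoped Matrix Kronecker RestrictedProduct NumberField TensorProduct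
open NumberField NumberField.mixedEmbedding IsDedekindDomain Filter
open Literature.NumberTheory Literature.NumberTheory.Automorphic Literature.NumberTheory.Automorphic.UnitaryGroup
open Literature.NumberTheory.GelbartRogawski1991 Literature.NumberTheory.GelbartRogawski1991.UnitaryDualPair
open Literature.NumberTheory.GelbartRogawski1991.UnitaryDualPair.WeilCoinv
open Literature.NumberTheory.GelbartRogawski1991.UnitaryDualPair.LocalSplitting
open Literature.NumberTheory.GelbartRogawski1991.GRConstruction
open Literature.NumberTheory.Weil1964 Literature.RepresentationTheory
open Literature.RepresentationTheory.HeisenbergGroup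
open Literature.NumberTheory.GaloisRepresentations Literature.RepresentationTheory.HarrisKudlaSweet1996
open Literature.NumberTheory.Automorphic.IdeleClassGroup Literature.RepresentationTheory.Liu2021
open Literature.NumberTheory.Automorphic.Liu2021 Literature.NumberTheory.Automorphic.Liu2021.Def411WeilCarriers
open Literature.NumberTheory.Automorphic.Liu2021.Def411WeilCarriersDoubling
open NumberField.InfinitePlace
open scoped ComplexOrder
open Literature.NumberTheory.ComplexMultiplication (CMTypeOps.bar CMTypeOps.mem_bar_iff)
open Summit.HodgeConjecture.HodgeConjecture.Cruxes.HLiu418.F0P5CurveThetaCompanionRelabelOfLocalFactors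

namespace Summit.HodgeConjecture.HodgeConjecture.Cruxes.HLiu418.F0P5CurveThetaCompanionRelabelOfNonsplitIfLetter

variable (L : Type) [Field L] [NumberField L] [IsCMField L]

/-! ## §1 The «if» half of [Liu2021, Lem. D.1 (4)] at ONE non-split place, read on the two members, gives the companion local isomorphism -/

section Members

variable {n' : ℕ} (e₁ : Fin 2 × Fin 1 ≃ Fin n') (dV : Fin 2 → L) (hdV : ∀ i, IsCMField.complexConj L (dV i) = dV i) (hdV0 : ∀ i, dV i ≠ 0)
  (lam : Literature.NumberTheory.Automorphic.IdeleClassGroup L →ₜ* Circle) (hlam : IsConjugateSymplectic L lam)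
  (a : (Fp L)ˣ) (χ : Chi (Fp L) L (IsCMField.complexConj L)) (a' : (Fp L)ˣ)
  (lam' : Literature.NumberTheory.Automorphic.IdeleClassGroup L →ₜ* Circle) (hlam' : IsConjugateSymplectic L lam')
  (v : HeightOneSpectrum (𝓞 (Fp L)))

set_option maxHeartbeats 800000 in -- MEASURING
/-- **The companion local isomorphism at `v` from the «IF» HALF of [Liu2021, Lemma D.1 (4)]** (READING I3, second alternative, on the members
`0 := (λ, a, χ)`, `1 := (λ′, a′, χ)`; ★ `LemD1_4IfAsPrintedI`): `λ′ = λᶜ·χ̌`, the local norm classes of `a′`, `a` at `v` agree iff `(L_v², diag dV)` is isotropic,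
`Θ_v(λ, a, χ) ≠ 0` ⇒ `Θ_v(λ′, a′, χ) ≅ Θ_v(λ, a, χ)` on `U(diag dV)(L⁺_v)` — ★ R2′-J `muOf_localMu_eq_muTwist` (`μ′_v = μ_vᶜ·χ̌_v`), ★ `localCharOfCenter_theta_eq`
(`χ′_v = χ_v`), ★ L1 `sameClass_epsLine_iff_locF_apply_eq` (class clause); transport to the local factors by ★ (r1) `areIsomorphicRep_localType₂_iff_quot` ∕
`nontrivial_localType₂_iff_quot`. [cite: Liu2021, App. D Lemma D.1 (4) (l. 5235, p. 126); §D.1 Steps 1–3 (l. 5213–5224)] -/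
theorem areIsomorphicRep_localFactor_companion_of_lemD1_4IfAsPrintedI
    (hcc : IsCMField.complexConj L * IsCMField.complexConj L = 1)
    (hH : toHeckeCharacter L lam' =
      toHeckeCharacter L (IdeleClassGroup.galConj (IsCMField.complexConj L) lam) * HeckeCharacter.checkOfChi hcc χ)
    (hJh : ((Matrix.diagonal dV).map (IsCMField.complexConj L))ᵀ = Matrix.diagonal dV) (hJdet : (Matrix.diagonal dV).det ≠ 0)
    (hflipv : locF (Fp L) (imagUnitSq L) a' v = locF (Fp L) (imagUnitSq L) a v ↔
      LemD1.IsIsotropic (LemD1OfPlace.standingData L v (IsCMField.complexConj L) 2 (Matrix.diagonal dV)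
        (complexConj_imagUnit L) (imagUnit_ne_zero L) le_rfl hJh hJdet))
    (hi : Nontrivial (TwistedCoinv.Coinv (show Representation ℂ (UnitaryGroup.localPi L (IsCMField.complexConj L) 1 (JW (Fp L) L a) v) (SchwartzBruhat (Fin n' → v.adicCompletion (Fp L))) from (((congrW L e₁ dV hdV (lineW L (TW (Fp L) a)) (complexConj_lineW L (TW (Fp L) a)) (realDiagonal_lineW L (TW (Fp L) a)) (diagonal_lineW L (TW (Fp L) a) (JW_eq (Fp L) L a)) (undoubledSplittings L e₁ dV hdV hdV0 (lineW L (TW (Fp L) a)) (complexConj_lineW L (TW (Fp L) a)) (lineW_ne_zero L (TW (Fp L) a) (isUnit_det_TW (Fp L) a)) (toHeckeCharacter L lam) (borelPlaceMeasure L) (cmFinLocalFamily L e₁ dV hdV hdV0 (lineW L (TW (Fp L) a)) (complexConj_lineW L (TW (Fp L) a)) (lineW_ne_zero L (TW (Fp L) a) (isUnit_det_TW (Fp L) a)) (toHeckeCharacter L lam) ((isOscillatorChar_toHeckeCharacter_iff lam).mpr hlam) (borelPlaceMeasure L))) (isSymm_TW (Fp L) a) (JW_eq (Fp L) L a))).omegaLoc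 v).comp (localCenter L (IsCMField.complexConj L) n' (Matrix.reindex e₁ e₁ (Matrix.diagonal dV ⊗ₖ JW (Fp L) L a)) (JW (Fp L) L a) (JW_apply_ne_zero (Fp L) L a) v)) (localCharOfCenter (Fp L) L (IsCMField.complexConj L) (JW (Fp L) L a) (JW_apply_ne_zero (Fp L) L a) χ.1 v)))
    (h4v : LemD1_4IfAsPrintedI (localIndexedFamilyAtV₂ (Fp L) L (IsCMField.complexConj L) 2 e₁ (Matrix.diagonal dV) (complexConj_imagUnit L) (imagUnit_ne_zero L) (imagUnit_mul_self L) (realDiagonal_isSymm L dV hdV) (isUnit_det_realDiagonal L dV hdV hdV0) (realDiagonal_map L dV hdV).symm (two_le_of_finTwo_equiv e₁) ![a, a'] (fun _ => χ) (Fin.cons (α := fun i : Fin 2 => LocalSplitting.FinLocalSplittings (Fp L) L (IsCMField.complexConj L) n' (complexConj_imagUnit L) (imagUnit_ne_zero L) (imagUnit_mul_self L) (gram (Fp L) e₁ (realDiagonal L dV hdV) (TW (Fp L) (![a, a'] i))) (isSymm_gram (Fp L) e₁ (realDiagonal_isSymm L dV hdV) (isSymm_TW (Fp L) (![a, a'] i)))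 (reindex_kronecker_eq_gram_map (Fp L) L e₁ (realDiagonal_map L dV hdV).symm (JW_eq (Fp L) L (![a, a'] i)))) (congrW L e₁ dV hdV (lineW L (TW (Fp L) a)) (complexConj_lineW L (TW (Fp L) a)) (realDiagonal_lineW L (TW (Fp L) a)) (diagonal_lineW L (TW (Fp L) a) (JW_eq (Fp L) L a)) (undoubledSplittings L e₁ dV hdV hdV0 (lineW L (TW (Fp L) a)) (complexConj_lineW L (TW (Fp L) a)) (lineW_ne_zero L (TW (Fp L) a) (isUnit_det_TW (Fp L) a)) (toHeckeCharacter L lam) (borelPlaceMeasure L) (cmFinLocalFamily L e₁ dV hdV hdV0 (lineW L (TW (Fp L) a)) (complexConj_lineW L (TW (Fp L) a)) (lineW_ne_zero L (TW (Fp L) a) (isUnit_det_TW (Fp L) a)) (toHeckeCharacter L lam) ((isOscillatorChar_toHeckeCharacter_iff lam).mpr hlam) (borelPlaceMeasure L))) (isSymm_TW (Fp L) a) (JW_eq (Fp L) L a)) (Fin.cons (congrW L e₁ dV hdV (lineW L (TW (Fp L) a')) (complexConj_lineW L (TW (Fp L) a')) (realDiagonal_lineW L (TW (Fp L) a')) (diagonal_lineW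 L (TW (Fp L) a') (JW_eq (Fp L) L a')) (undoubledSplittings L e₁ dV hdV hdV0 (lineW L (TW (Fp L) a')) (complexConj_lineW L (TW (Fp L) a')) (lineW_ne_zero L (TW (Fp L) a') (isUnit_det_TW (Fp L) a')) (toHeckeCharacter L lam') (borelPlaceMeasure L) (cmFinLocalFamily L e₁ dV hdV hdV0 (lineW L (TW (Fp L) a')) (complexConj_lineW L (TW (Fp L) a')) (lineW_ne_zero L (TW (Fp L) a') (isUnit_det_TW (Fp L) a')) (toHeckeCharacter L lam') ((isOscillatorChar_toHeckeCharacter_iff lam').mpr hlam') (borelPlaceMeasure L))) (isSymm_TW (Fp L) a') (JW_eq (Fp L) L a')) finZeroElim)) ![localMu L (toHeckeCharacter L lam), localMu L (toHeckeCharacter L lam')] (norm_localMu_pair L lam lam') (continuous_localMu_pair L lam lam') (localMu_pair_toLocalRing_eq_one_iff L lam hlam lam' hlam') v)) :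
    AreIsomorphicRep (show Representation ℂ (localPi L (IsCMField.complexConj L) 2 (Matrix.diagonal dV) v) _ from (TwistedCoinv.rep (localCharOfCenter (Fp L) L (IsCMField.complexConj L) (JW (Fp L) L a') (JW_apply_ne_zero (Fp L) L a') χ.1 v) (((congrW L e₁ dV hdV (lineW L (TW (Fp L) a')) (complexConj_lineW L (TW (Fp L) a')) (realDiagonal_lineW L (TW (Fp L) a')) (diagonal_lineW L (TW (Fp L) a') (JW_eq (Fp L) L a')) (undoubledSplittings L e₁ dV hdV hdV0 (lineW L (TW (Fp L) a')) (complexConj_lineW L (TW (Fp L) a')) (lineW_ne_zero L (TW (Fp L) a') (isUnit_det_TW (Fp L) a')) (toHeckeCharacter L lam') (borelPlaceMeasure L) (cmFinLocalFamily L e₁ dV hdV hdV0 (lineW L (TW (Fp L) a')) (complexConj_lineW L (TW (Fp L) a')) (lineW_ne_zero L (TW (Fp L) a') (isUnit_det_TW (Fp L) a')) (toHeckeCharacter L lam') ((isOscillatorChar_toHeckeCharacter_iff lam').mpr hlam') (borelPlaceMeasure L))) (isSymm_TW (Fp L) a') (JW_eq (Fp L) L a'))).omegaLoc v) (commute_omegaLoc_localCenter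 (Fp L) L (IsCMField.complexConj L) 2 e₁ (Matrix.diagonal dV) (JW (Fp L) L a') (complexConj_imagUnit L) (imagUnit_ne_zero L) (imagUnit_mul_self L) (realDiagonal_isSymm L dV hdV) (isSymm_TW (Fp L) a') (realDiagonal_map L dV hdV).symm (JW_eq (Fp L) L a') (JW_apply_ne_zero (Fp L) L a') (congrW L e₁ dV hdV (lineW L (TW (Fp L) a')) (complexConj_lineW L (TW (Fp L) a')) (realDiagonal_lineW L (TW (Fp L) a')) (diagonal_lineW L (TW (Fp L) a') (JW_eq (Fp L) L a')) (undoubledSplittings L e₁ dV hdV hdV0 (lineW L (TW (Fp L) a')) (complexConj_lineW L (TW (Fp L) a')) (lineW_ne_zero L (TW (Fp L) a') (isUnit_det_TW (Fp L) a')) (toHeckeCharacter L lam') (borelPlaceMeasure L) (cmFinLocalFamily L e₁ dV hdV hdV0 (lineW L (TW (Fp L) a')) (complexConj_lineW L (TW (Fp L) a')) (lineW_ne_zero L (TW (Fp L) a') (isUnit_det_TW (Fp L) a')) (toHeckeCharacter L lam') ((isOscillatorChar_toHeckeCharacter_iff lam').mpr hlam') (borelPlaceMeasure L))) (isSymm_TW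 (Fp L) a') (JW_eq (Fp L) L a')) v)).comp (localLineInl L (IsCMField.complexConj L) 2 e₁ (Matrix.diagonal dV) (JW (Fp L) L a') v)) (show Representation ℂ (localPi L (IsCMField.complexConj L) 2 (Matrix.diagonal dV) v) _ from (TwistedCoinv.rep (localCharOfCenter (Fp L) L (IsCMField.complexConj L) (JW (Fp L) L a) (JW_apply_ne_zero (Fp L) L a) χ.1 v) (((congrW L e₁ dV hdV (lineW L (TW (Fp L) a)) (complexConj_lineW L (TW (Fp L) a)) (realDiagonal_lineW L (TW (Fp L) a)) (diagonal_lineW L (TW (Fp L) a) (JW_eq (Fp L) L a)) (undoubledSplittings L e₁ dV hdV hdV0 (lineW L (TW (Fp L) a)) (complexConj_lineW L (TW (Fp L) a)) (lineW_ne_zero L (TW (Fp L) a) (isUnit_det_TW (Fp L) a)) (toHeckeCharacter L lam) (borelPlaceMeasure L) (cmFinLocalFamily L e₁ dV hdV hdV0 (lineW L (TW (Fp L) a)) (complexConj_lineW L (TW (Fp L) a)) (lineW_ne_zero L (TW (Fp L) a) (isUnit_det_TW (Fp L) a)) (toHeckeCharacter L lam) ((isOscillatorChar_toHeckeCharacter_iff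 lam).mpr hlam) (borelPlaceMeasure L))) (isSymm_TW (Fp L) a) (JW_eq (Fp L) L a))).omegaLoc v) (commute_omegaLoc_localCenter (Fp L) L (IsCMField.complexConj L) 2 e₁ (Matrix.diagonal dV) (JW (Fp L) L a) (complexConj_imagUnit L) (imagUnit_ne_zero L) (imagUnit_mul_self L) (realDiagonal_isSymm L dV hdV) (isSymm_TW (Fp L) a) (realDiagonal_map L dV hdV).symm (JW_eq (Fp L) L a) (JW_apply_ne_zero (Fp L) L a) (congrW L e₁ dV hdV (lineW L (TW (Fp L) a)) (complexConj_lineW L (TW (Fp L) a)) (realDiagonal_lineW L (TW (Fp L) a)) (diagonal_lineW L (TW (Fp L) a) (JW_eq (Fp L) L a)) (undoubledSplittings L e₁ dV hdV hdV0 (lineW L (TW (Fp L) a)) (complexConj_lineW L (TW (Fp L) a)) (lineW_ne_zero L (TW (Fp L) a) (isUnit_det_TW (Fp L) a)) (toHeckeCharacter L lam) (borelPlaceMeasure L) (cmFinLocalFamily L e₁ dV hdV hdV0 (lineW L (TW (Fp L) a)) (complexConj_lineW L (TW (Fp L) a)) (lineW_ne_zero L (TW (Fp L) a) (isUnit_det_TW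 (Fp L) a)) (toHeckeCharacter L lam) ((isOscillatorChar_toHeckeCharacter_iff lam).mpr hlam) (borelPlaceMeasure L))) (isSymm_TW (Fp L) a) (JW_eq (Fp L) L a)) v)).comp (localLineInl L (IsCMField.complexConj L) 2 e₁ (Matrix.diagonal dV) (JW (Fp L) L a) v)) := by
  have hi' := (nontrivial_localType₂_iff_quot (Fp L) L (IsCMField.complexConj L) 2 e₁ (Matrix.diagonal dV)
    (complexConj_imagUnit L) (imagUnit_ne_zero L) (imagUnit_mul_self L) (realDiagonal_isSymm L dV hdV)
    (isUnit_det_realDiagonal L dV hdV hdV0) (realDiagonal_map L dV hdV).symm (two_le_of_finTwo_equiv e₁) ![a, a'] (fun _ => χ)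
    (Fin.cons (α := fun i : Fin 2 => LocalSplitting.FinLocalSplittings (Fp L) L (IsCMField.complexConj L) n' (complexConj_imagUnit L) (imagUnit_ne_zero L) (imagUnit_mul_self L) (gram (Fp L) e₁ (realDiagonal L dV hdV) (TW (Fp L) (![a, a'] i))) (isSymm_gram (Fp L) e₁ (realDiagonal_isSymm L dV hdV) (isSymm_TW (Fp L) (![a, a'] i))) (reindex_kronecker_eq_gram_map (Fp L) L e₁ (realDiagonal_map L dV hdV).symm (JW_eq (Fp L) L (![a, a'] i)))) (congrW L e₁ dV hdV (lineW L (TW (Fp L) a)) (complexConj_lineW L (TW (Fp L) a)) (realDiagonal_lineW L (TW (Fp L) a)) (diagonal_lineW L (TW (Fp L) a) (JW_eq (Fp L) L a)) (undoubledSplittings L e₁ dV hdV hdV0 (lineW L (TW (Fp L) a)) (complexConj_lineW L (TW (Fp L) a)) (lineW_ne_zero L (TW (Fp L) a) (isUnit_det_TW (Fp L) a)) (toHeckeCharacter L lam) (borelPlaceMeasure L) (cmFinLocalFamily L e₁ dV hdV hdV0 (lineW L (TW (Fp L) a)) (complexConj_lineW L (TW (Fp L) a)) (lineW_ne_zero L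 (TW (Fp L) a) (isUnit_det_TW (Fp L) a)) (toHeckeCharacter L lam) ((isOscillatorChar_toHeckeCharacter_iff lam).mpr hlam) (borelPlaceMeasure L))) (isSymm_TW (Fp L) a) (JW_eq (Fp L) L a)) (Fin.cons (congrW L e₁ dV hdV (lineW L (TW (Fp L) a')) (complexConj_lineW L (TW (Fp L) a')) (realDiagonal_lineW L (TW (Fp L) a')) (diagonal_lineW L (TW (Fp L) a') (JW_eq (Fp L) L a')) (undoubledSplittings L e₁ dV hdV hdV0 (lineW L (TW (Fp L) a')) (complexConj_lineW L (TW (Fp L) a')) (lineW_ne_zero L (TW (Fp L) a') (isUnit_det_TW (Fp L) a')) (toHeckeCharacter L lam') (borelPlaceMeasure L) (cmFinLocalFamily L e₁ dV hdV hdV0 (lineW L (TW (Fp L) a')) (complexConj_lineW L (TW (Fp L) a')) (lineW_ne_zero L (TW (Fp L) a') (isUnit_det_TW (Fp L) a')) (toHeckeCharacter L lam') ((isOscillatorChar_toHeckeCharacter_iff lam').mpr hlam') (borelPlaceMeasure L))) (isSymm_TW (Fp L) a') (JW_eq (Fp L) L a')) finZeroElim)) ![localMu L (toHeckeCharacter L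 lam), localMu L (toHeckeCharacter L lam')]
    (norm_localMu_pair L lam lam') (continuous_localMu_pair L lam lam') (localMu_pair_toLocalRing_eq_one_iff L lam hlam lam' hlam') v 0).2 hi
  refine (areIsomorphicRep_localType₂_iff_quot (Fp L) L (IsCMField.complexConj L) 2 e₁ (Matrix.diagonal dV)
    (complexConj_imagUnit L) (imagUnit_ne_zero L) (imagUnit_mul_self L) (realDiagonal_isSymm L dV hdV)
    (isUnit_det_realDiagonal L dV hdV hdV0) (realDiagonal_map L dV hdV).symm (two_le_of_finTwo_equiv e₁) ![a, a'] (fun _ => χ)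
    (Fin.cons (α := fun i : Fin 2 => LocalSplitting.FinLocalSplittings (Fp L) L (IsCMField.complexConj L) n' (complexConj_imagUnit L) (imagUnit_ne_zero L) (imagUnit_mul_self L) (gram (Fp L) e₁ (realDiagonal L dV hdV) (TW (Fp L) (![a, a'] i))) (isSymm_gram (Fp L) e₁ (realDiagonal_isSymm L dV hdV) (isSymm_TW (Fp L) (![a, a'] i))) (reindex_kronecker_eq_gram_map (Fp L) L e₁ (realDiagonal_map L dV hdV).symm (JW_eq (Fp L) L (![a, a'] i)))) (congrW L e₁ dV hdV (lineW L (TW (Fp L) a)) (complexConj_lineW L (TW (Fp L) a)) (realDiagonal_lineW L (TW (Fp L) a)) (diagonal_lineW L (TW (Fp L) a) (JW_eq (Fp L) L a)) (undoubledSplittings L e₁ dV hdV hdV0 (lineW L (TW (Fp L) a)) (complexConj_lineW L (TW (Fp L) a)) (lineW_ne_zero L (TW (Fp L) a) (isUnit_det_TW (Fp L) a)) (toHeckeCharacter L lam) (borelPlaceMeasure L) (cmFinLocalFamily L e₁ dV hdV hdV0 (lineW L (TW (Fp L) a)) (complexConj_lineW L (TW (Fp L) a)) (lineW_ne_zero L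 (TW (Fp L) a) (isUnit_det_TW (Fp L) a)) (toHeckeCharacter L lam) ((isOscillatorChar_toHeckeCharacter_iff lam).mpr hlam) (borelPlaceMeasure L))) (isSymm_TW (Fp L) a) (JW_eq (Fp L) L a)) (Fin.cons (congrW L e₁ dV hdV (lineW L (TW (Fp L) a')) (complexConj_lineW L (TW (Fp L) a')) (realDiagonal_lineW L (TW (Fp L) a')) (diagonal_lineW L (TW (Fp L) a') (JW_eq (Fp L) L a')) (undoubledSplittings L e₁ dV hdV hdV0 (lineW L (TW (Fp L) a')) (complexConj_lineW L (TW (Fp L) a')) (lineW_ne_zero L (TW (Fp L) a') (isUnit_det_TW (Fp L) a')) (toHeckeCharacter L lam') (borelPlaceMeasure L) (cmFinLocalFamily L e₁ dV hdV hdV0 (lineW L (TW (Fp L) a')) (complexConj_lineW L (TW (Fp L) a')) (lineW_ne_zero L (TW (Fp L) a') (isUnit_det_TW (Fp L) a')) (toHeckeCharacter L lam') ((isOscillatorChar_toHeckeCharacter_iff lam').mpr hlam') (borelPlaceMeasure L))) (isSymm_TW (Fp L) a') (JW_eq (Fp L) L a')) finZeroElim)) ![localMu L (toHeckeCharacter L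 lam), localMu L (toHeckeCharacter L lam')]
    (norm_localMu_pair L lam lam') (continuous_localMu_pair L lam lam') (localMu_pair_toLocalRing_eq_one_iff L lam hlam lam' hlam') v 0 1).1
    (h4v rfl 0 hi' 1 ?_ ?_ ?_ ?_)
  · -- `μ′_v = μ_vᶜ · χ̌_v` (★ R2′-J)
    haveI := LemD1OfPlace.isModuleTopology_localRing L v
    have hH' : toHeckeCharacter L lam' =
        HeckeCharacter.galConj (IsCMField.complexConj L) (toHeckeCharacter L lam) * HeckeCharacter.checkOfChi hcc χ := by
      rw [hH, toHeckeCharacter_galConj]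
    exact CheckOfChi.muOf_localMu_eq_muTwist L hcc χ (complexConj_imagUnit L) (imagUnit_ne_zero L) _ _ _
      (JW_apply_ne_zero (Fp L) L a) (toHeckeCharacter L lam) (toHeckeCharacter L lam') hH'
      (norm_localMu_pair L lam lam' 1 v) (continuous_localMu_pair L lam lam' 1 v)
      (localMu_pair_toLocalRing_eq_one_iff L lam hlam lam' hlam' 1 v)
      (norm_localMu_pair L lam lam' 0 v) (continuous_localMu_pair L lam lam' 0 v)
      (localMu_pair_toLocalRing_eq_one_iff L lam hlam lam' hlam' 0 v)
      (norm_localCharOfCenter (Fp L) L (IsCMField.complexConj L) (JW (Fp L) L a) (JW_apply_ne_zero (Fp L) L a)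
        (norm_chi_eq_one (Fp L) L (IsCMField.complexConj L) (Algebra.IsQuadraticExtension.finrank_eq_two (Fp L) L)
          (UnitaryGroup.algEquiv_ne_one_of_apply_eq_neg (Fp L) L (IsCMField.complexConj L) (complexConj_imagUnit L)
            (imagUnit_ne_zero L)) χ) v)
      (continuous_coe_localCharOfCenter (Fp L) L (IsCMField.complexConj L) (JW (Fp L) L a) (JW_apply_ne_zero (Fp L) L a) χ.2.1 v)
  · -- `χ′_v = χ_v`: the centre read through the line `⟨a′⟩` or `⟨a⟩`
    refine Subtype.ext (MonoidHom.ext fun z => ?_)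
    exact localCharOfCenter_theta_eq (Fp L) L (IsCMField.complexConj L) 2 (Matrix.diagonal dV) (complexConj_imagUnit L)
      (imagUnit_ne_zero L) _ _ _ v (JW (Fp L) L a') (JW (Fp L) L a) (JW_apply_ne_zero (Fp L) L a') (JW_apply_ne_zero (Fp L) L a) χ.1 z
  · -- isotropic ⇒ same class (★ L1)
    intro hV
    exact sameClass_epsLine_of_locF_apply_eq (Fp L) L (IsCMField.complexConj L) 2 (Matrix.diagonal dV) (complexConj_imagUnit L)
      (imagUnit_ne_zero L) (imagUnit_mul_self L) le_rfl hJh hJdet v a a' (hflipv.2 hV).symm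
  · -- anisotropic ⇒ different classes (★ `locF_apply_eq_of_sameClass_epsLine`)
    intro hV hcls
    exact hV (hflipv.1 (locF_apply_eq_of_sameClass_epsLine (Fp L) L (IsCMField.complexConj L) 2 (Matrix.diagonal dV)
      (complexConj_imagUnit L) (imagUnit_ne_zero L) (imagUnit_mul_self L) le_rfl hJh hJdet v a a' hcls).symm)

end Members

/-! ## §2 THE ASSEMBLY with the single «if» letter BY NAME -/

set_option maxHeartbeats 800000 in -- MEASURING
/-- **Stub R2′ `CompanionRelabelTransfer₂` CLOSED MODULO ONE LETTER — the «IF» HALF of [Liu2021, Lem. D.1 (4)] at the NON-SPLIT places** (registered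
signature UNFOLDED verbatim): `h4if` = ★ `LemD1RankTwoCMLetters.LemD1_4IfAsPrintedNonsplitCM₂` BY NAME («if» direction, second alternative, READING I3 on the
members `(λ, a, χ)`, `(λ′, a′, χ)`).  `σ ↪ ω(λ, ε_a, χ)_f` injective ⇒ `σ ↪ ω(λ′, ε_{a′}, χ)_f` injective, `λ′ := λᶜ·χ̌` (conjugate symplectic, weight one, CM type
`Φ̄_λ`), `a′` flipped exactly on the anisotropic places; no second letter (the line clause of the gluing is ★ (E2), hypothesis-free).
[cite: Liu2021, App. D Lem. D.1 (4) (p. 126) and its proof (p. 126–127); Rem. 4.4] [cite: HarrisKudlaSweet1996, Thm. 6.1] [cite: Flath1979, §2 Example 2] -/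
theorem companionRelabelTransfer₂_of_nonsplit_if_letter
    (h4if : Literature.NumberTheory.Automorphic.Liu2021.LemD1RankTwoCMLetters.LemD1_4IfAsPrintedNonsplitCM₂) :
  ∀ (L : Type) [Field L] [NumberField L] [IsCMField L] (ι : L →+* ℂ) (H : Matrix (Fin 2) (Fin 2) L)
    (dV : Fin 2 → L) (hdV : ∀ i, IsCMField.complexConj L (dV i) = dV i) (hdV0 : ∀ i, dV i ≠ 0)
    (t : L) (ht : t ≠ 0) (g : GL (Fin 2) L)
    (hg : formCongr ((IsCMField.complexConj L : L ≃ₐ[↥(maximalRealSubfield L)] L) : L →+* L) g (t • H) = Matrix.diagonal dV),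
    (∃ T : GL (Fin 2) ℂ, formCongr (starRingEnd ℂ) T ((Matrix.diagonal dV).map ι) = Matrix.diagonal ![(1 : ℂ), -1]) →
    (∀ τ' : L →+* ℂ, InfinitePlace.mk τ' ≠ InfinitePlace.mk ι → ((Matrix.diagonal dV).map τ').PosDef) →
    4 ≤ Module.finrank ℚ L →
    ∀ {n' : ℕ} (e₁ : Fin 2 × Fin 1 ≃ Fin n')
      (lam : Literature.NumberTheory.Automorphic.IdeleClassGroup L →ₜ* Circle) (hlam : IsConjugateSymplectic L lam), HasWeight L lam 1 →
    ∀ (a : (↥(maximalRealSubfield L))ˣ) (χ : Chi (↥(maximalRealSubfield L)) L (IsCMField.complexConj L))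
      (W : Type) [AddCommGroup W] [Module ℂ W]
      (σ : Representation ℂ (finAdelic (↥(maximalRealSubfield L)) L (IsCMField.complexConj L) 2 H) W),
      σ.IsIrreducible → σ.IsSmooth →
    ∀ j : σ.IntertwiningMap
        ((rhoVAtLine (↥(maximalRealSubfield L)) L (IsCMField.complexConj L) 2 e₁ (Matrix.diagonal dV)
            (complexConj_imagUnit L) (imagUnit_ne_zero L) (imagUnit_mul_self L) (realDiagonal_isSymm L dV hdV)
            (isUnit_det_realDiagonal L dV hdV hdV0) (realDiagonal_map L dV hdV).symm
            (fun a => isCompatible_chiSplittingLine L e₁ dV hdV hdV0 (toHeckeCharacter L lam)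
              (isUnitary_toHeckeCharacter L lam) ((isOscillatorChar_toHeckeCharacter_iff lam).mpr hlam)
              (TW (↥(maximalRealSubfield L)) a) (isSymm_TW (↥(maximalRealSubfield L)) a)
              (isUnit_det_TW (↥(maximalRealSubfield L)) a) (JW (↥(maximalRealSubfield L)) L a)
              (JW_eq (↥(maximalRealSubfield L)) L a)) a χ).comp
          (finAdelicCongr (↥(maximalRealSubfield L)) L (IsCMField.complexConj L) g ht hg).symm.toMonoidHom),
      Function.Injective j →
    ∀ a' : (↥(maximalRealSubfield L))ˣ,
      (∀ (hJh : ((Matrix.diagonal dV).map (IsCMField.complexConj L))ᵀ = Matrix.diagonal dV) (hJdet : (Matrix.diagonal dV).det ≠ 0)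
          (v : HeightOneSpectrum (𝓞 ↥(maximalRealSubfield L))),
        locF (↥(maximalRealSubfield L)) (imagUnitSq L) a' v = locF (↥(maximalRealSubfield L)) (imagUnitSq L) a v ↔
          LemD1.IsIsotropic (LemD1OfPlace.standingData L v (IsCMField.complexConj L) 2 (Matrix.diagonal dV)
            (complexConj_imagUnit L) (imagUnit_ne_zero L) le_rfl hJh hJdet)) →
      ∃ (lam' : Literature.NumberTheory.Automorphic.IdeleClassGroup L →ₜ* Circle) (hlam' : IsConjugateSymplectic L lam'),
        HasWeight L lam' 1 ∧ hlam'.cmType = CMTypeOps.bar hlam.cmType ∧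
        ∃ j' : σ.IntertwiningMap
            ((rhoVAtLine (↥(maximalRealSubfield L)) L (IsCMField.complexConj L) 2 e₁ (Matrix.diagonal dV)
                (complexConj_imagUnit L) (imagUnit_ne_zero L) (imagUnit_mul_self L) (realDiagonal_isSymm L dV hdV)
                (isUnit_det_realDiagonal L dV hdV hdV0) (realDiagonal_map L dV hdV).symm
                (fun a => isCompatible_chiSplittingLine L e₁ dV hdV hdV0 (toHeckeCharacter L lam') (isUnitary_toHeckeCharacter L lam')
                  ((isOscillatorChar_toHeckeCharacter_iff lam').mpr hlam')
                  (TW (↥(maximalRealSubfield L)) a) (isSymm_TW (↥(maximalRealSubfield L)) a)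
                  (isUnit_det_TW (↥(maximalRealSubfield L)) a) (JW (↥(maximalRealSubfield L)) L a)
                  (JW_eq (↥(maximalRealSubfield L)) L a)) a' χ).comp
              (finAdelicCongr (↥(maximalRealSubfield L)) L (IsCMField.complexConj L) g ht hg).symm.toMonoidHom),
          Function.Injective j'
    := by
  intro L _ _ _ ι H dV hdV hdV0 t ht g hg hsig hdef h4L n' e₁ lam hlam hw a χ W _ _ σ hirr hsm j hj a' hflip
  -- the frame `diag dV` and the rank
  have hcc : IsCMField.complexConj L * IsCMField.complexConj L = 1 :=
    AlgEquiv.ext fun x => by rw [AlgEquiv.mul_apply, IsCMField.complexConj_apply_apply, AlgEquiv.one_apply]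
  have hJh : ((Matrix.diagonal dV).map (IsCMField.complexConj L))ᵀ = Matrix.diagonal dV := by
    rw [Matrix.diagonal_map (map_zero (IsCMField.complexConj L)), Matrix.diagonal_transpose]
    exact congrArg Matrix.diagonal (funext hdV)
  have hJdet : (Matrix.diagonal dV).det ≠ 0 := by
    rw [Matrix.det_diagonal]
    exact Finset.prod_ne_zero_iff.2 fun i _ => hdV0 i
  haveI : NeZero n' := ⟨by rw [eq_two_of_finTwo_equiv e₁]; decide⟩
  -- the companion label `λ′ = λᶜ·χ̌`: conjugate symplectic, weight one, CM type `Φ̄_λ`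
  obtain ⟨lam', hH, hlam', hw', hΦ'⟩ := hlam.exists_companion_galConj_mul_checkOfChi hcc χ hw
  -- `ω(λ, ε_a, χ)_f ≠ 0` (it receives the irreducible `σ`), hence every local factor `Θ_v(λ, a, χ) ≠ 0`
  haveI : σ.IsIrreducible := hirr
  haveI : Nontrivial W := Representation.IsIrreducible.nontrivial σ
  haveI := hj.nontrivial
  -- member-wise local isomorphisms: split `v` in-house (GL₂ Weyl symmetry), non-split `v` from the «if» letter
  have hiso : ∀ v : HeightOneSpectrum (𝓞 (Fp L)), AreIsomorphicRep (show Representation ℂ (localPi L (IsCMField.complexConj L) 2 (Matrix.diagonal dV) v) _ from (TwistedCoinv.rep (localCharOfCenter (Fp L) L (IsCMField.complexConj L) (JW (Fp L) L a) (JW_apply_ne_zero (Fp L) L a) χ.1 v) (((congrW L e₁ dV hdV (lineW L (TW (Fp L) a)) (complexConj_lineW L (TW (Fp L) a)) (realDiagonal_lineW L (TW (Fp L) a)) (diagonal_lineW L (TW (Fp L) a) (JW_eq (Fp L) L a)) (undoubledSplittings L e₁ dV hdV hdV0 (lineW L (TW (Fp L) a)) (complexConj_lineW L (TW (Fp L)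 a)) (lineW_ne_zero L (TW (Fp L) a) (isUnit_det_TW (Fp L) a)) (toHeckeCharacter L lam) (borelPlaceMeasure L) (cmFinLocalFamily L e₁ dV hdV hdV0 (lineW L (TW (Fp L) a)) (complexConj_lineW L (TW (Fp L) a)) (lineW_ne_zero L (TW (Fp L) a) (isUnit_det_TW (Fp L) a)) (toHeckeCharacter L lam) ((isOscillatorChar_toHeckeCharacter_iff lam).mpr hlam) (borelPlaceMeasure L))) (isSymm_TW (Fp L) a) (JW_eq (Fp L) L a))).omegaLoc v) (commute_omegaLoc_localCenter (Fp L) L (IsCMField.complexConj L) 2 e₁ (Matrix.diagonal dV) (JW (Fp L) L a) (complexConj_imagUnit L) (imagUnit_ne_zero L) (imagUnit_mul_self L) (realDiagonal_isSymm L dV hdV) (isSymm_TW (Fp L) a) (realDiagonal_map L dV hdV).symm (JW_eq (Fp L) L a) (JW_apply_ne_zero (Fp L) L a) (congrW L e₁ dV hdV (lineW L (TW (Fp L) a)) (complexConj_lineW L (TW (Fp L) a)) (realDiagonal_lineW L (TW (Fp L) a)) (diagonal_lineW L (TW (Fp L) a) (JW_eq (Fp L) L a)) (undoubledSplittings L e₁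 dV hdV hdV0 (lineW L (TW (Fp L) a)) (complexConj_lineW L (TW (Fp L) a)) (lineW_ne_zero L (TW (Fp L) a) (isUnit_det_TW (Fp L) a)) (toHeckeCharacter L lam) (borelPlaceMeasure L) (cmFinLocalFamily L e₁ dV hdV hdV0 (lineW L (TW (Fp L) a)) (complexConj_lineW L (TW (Fp L) a)) (lineW_ne_zero L (TW (Fp L) a) (isUnit_det_TW (Fp L) a)) (toHeckeCharacter L lam) ((isOscillatorChar_toHeckeCharacter_iff lam).mpr hlam) (borelPlaceMeasure L))) (isSymm_TW (Fp L) a) (JW_eq (Fp L) L a)) v)).comp (localLineInl L (IsCMField.complexConj L) 2 e₁ (Matrix.diagonal dV) (JW (Fp L) L a) v)) (show Representation ℂ (localPi L (IsCMField.complexConj L) 2 (Matrix.diagonal dV) v) _ from (TwistedCoinv.rep (localCharOfCenter (Fp L) L (IsCMField.complexConj L) (JW (Fp L) L a') (JW_apply_ne_zero (Fp L) L a') χ.1 v) (((congrW L e₁ dV hdV (lineW L (TW (Fp L) a')) (complexConj_lineW L (TW (Fp L) a')) (realDiagonal_lineW L (TW (Fp L) a')) (diagonal_lineW L (TW (Fp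 L) a') (JW_eq (Fp L) L a')) (undoubledSplittings L e₁ dV hdV hdV0 (lineW L (TW (Fp L) a')) (complexConj_lineW L (TW (Fp L) a')) (lineW_ne_zero L (TW (Fp L) a') (isUnit_det_TW (Fp L) a')) (toHeckeCharacter L lam') (borelPlaceMeasure L) (cmFinLocalFamily L e₁ dV hdV hdV0 (lineW L (TW (Fp L) a')) (complexConj_lineW L (TW (Fp L) a')) (lineW_ne_zero L (TW (Fp L) a') (isUnit_det_TW (Fp L) a')) (toHeckeCharacter L lam') ((isOscillatorChar_toHeckeCharacter_iff lam').mpr hlam') (borelPlaceMeasure L))) (isSymm_TW (Fp L) a') (JW_eq (Fp L) L a'))).omegaLoc v) (commute_omegaLoc_localCenter (Fp L) L (IsCMField.complexConj L) 2 e₁ (Matrix.diagonal dV) (JW (Fp L) L a') (complexConj_imagUnit L) (imagUnit_ne_zero L) (imagUnit_mul_self L) (realDiagonal_isSymm L dV hdV) (isSymm_TW (Fp L) a') (realDiagonal_map L dV hdV).symm (JW_eq (Fp L) L a') (JW_apply_ne_zero (Fp L) L a') (congrW L e₁ dV hdV (lineW L (TW (Fp L) a')) (complexConj_lineW L (TW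 (Fp L) a')) (realDiagonal_lineW L (TW (Fp L) a')) (diagonal_lineW L (TW (Fp L) a') (JW_eq (Fp L) L a')) (undoubledSplittings L e₁ dV hdV hdV0 (lineW L (TW (Fp L) a')) (complexConj_lineW L (TW (Fp L) a')) (lineW_ne_zero L (TW (Fp L) a') (isUnit_det_TW (Fp L) a')) (toHeckeCharacter L lam') (borelPlaceMeasure L) (cmFinLocalFamily L e₁ dV hdV hdV0 (lineW L (TW (Fp L) a')) (complexConj_lineW L (TW (Fp L) a')) (lineW_ne_zero L (TW (Fp L) a') (isUnit_det_TW (Fp L) a')) (toHeckeCharacter L lam') ((isOscillatorChar_toHeckeCharacter_iff lam').mpr hlam') (borelPlaceMeasure L))) (isSymm_TW (Fp L) a') (JW_eq (Fp L) L a')) v)).comp (localLineInl L (IsCMField.complexConj L) 2 e₁ (Matrix.diagonal dV) (JW (Fp L) L a') v)) := by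
    intro v
    by_cases hsplit : ∃ w : UnitaryGroup.PlacesOver L v, IsCMField.complexConj L • (w : HeightOneSpectrum (𝓞 L)) ≠ w
    · obtain ⟨w, hw⟩ := hsplit
      exact (areIsomorphicRep_localFactor_comp_localLineInl_of_split L (IsCMField.complexConj_ne_one L) e₁ dV hdV hdV0 a a' χ χ
        (congrW L e₁ dV hdV (lineW L (TW (Fp L) a)) (complexConj_lineW L (TW (Fp L) a)) (realDiagonal_lineW L (TW (Fp L) a)) (diagonal_lineW L (TW (Fp L) a) (JW_eq (Fp L) L a)) (undoubledSplittings L e₁ dV hdV hdV0 (lineW L (TW (Fp L) a)) (complexConj_lineW L (TW (Fp L) a)) (lineW_ne_zero L (TW (Fp L) a) (isUnit_det_TW (Fp L) a)) (toHeckeCharacter L lam) (borelPlaceMeasure L) (cmFinLocalFamily L e₁ dV hdV hdV0 (lineW L (TW (Fp L) a)) (complexConj_lineW L (TW (Fp L) a)) (lineW_ne_zero L (TW (Fp L) a) (isUnit_det_TW (Fp L) a)) (toHeckeCharacter L lam) ((isOscillatorChar_toHeckeCharacter_iff lam).mpr hlam) (borelPlaceMeasure L))) (isSymm_TW (Fp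 L) a) (JW_eq (Fp L) L a)) (congrW L e₁ dV hdV (lineW L (TW (Fp L) a')) (complexConj_lineW L (TW (Fp L) a')) (realDiagonal_lineW L (TW (Fp L) a')) (diagonal_lineW L (TW (Fp L) a') (JW_eq (Fp L) L a')) (undoubledSplittings L e₁ dV hdV hdV0 (lineW L (TW (Fp L) a')) (complexConj_lineW L (TW (Fp L) a')) (lineW_ne_zero L (TW (Fp L) a') (isUnit_det_TW (Fp L) a')) (toHeckeCharacter L lam') (borelPlaceMeasure L) (cmFinLocalFamily L e₁ dV hdV hdV0 (lineW L (TW (Fp L) a')) (complexConj_lineW L (TW (Fp L) a')) (lineW_ne_zero L (TW (Fp L) a') (isUnit_det_TW (Fp L) a')) (toHeckeCharacter L lam') ((isOscillatorChar_toHeckeCharacter_iff lam').mpr hlam') (borelPlaceMeasure L))) (isSymm_TW (Fp L) a') (JW_eq (Fp L) L a'))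
        (toHeckeCharacter L lam) (toHeckeCharacter L lam')
        ((isOscillatorChar_toHeckeCharacter_iff lam).mpr hlam) ((isOscillatorChar_toHeckeCharacter_iff lam').mpr hlam')
        (isUnitary_toHeckeCharacter L lam) (isUnitary_toHeckeCharacter L lam') v w hw
        (congrW_undoubledSplittings_cmFinLocalFamily_s L e₁ dV hdV hdV0 (lineW L (TW (Fp L) a)) (complexConj_lineW L (TW (Fp L) a))
          (lineW_ne_zero L (TW (Fp L) a) (isUnit_det_TW (Fp L) a)) (toHeckeCharacter L lam) ((isOscillatorChar_toHeckeCharacter_iff lam).mpr hlam)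
          (realDiagonal_lineW L (TW (Fp L) a)) (diagonal_lineW L (TW (Fp L) a) (JW_eq (Fp L) L a)) (isSymm_TW (Fp L) a) (isUnit_det_TW (Fp L) a)
          (JW_eq (Fp L) L a) v)
        (congrW_undoubledSplittings_cmFinLocalFamily_s L e₁ dV hdV hdV0 (lineW L (TW (Fp L) a')) (complexConj_lineW L (TW (Fp L) a'))
          (lineW_ne_zero L (TW (Fp L) a') (isUnit_det_TW (Fp L) a')) (toHeckeCharacter L lam') ((isOscillatorChar_toHeckeCharacter_iff lam').mpr hlam')
          (realDiagonal_lineW L (TW (Fp L) a')) (diagonal_lineW L (TW (Fp L) a') (JW_eq (Fp L) L a')) (isSymm_TW (Fp L) a') (isUnit_det_TW (Fp L) a')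
          (JW_eq (Fp L) L a') v)
        ((HeckeCharacter.checkOfChi hcc χ).localComponent (w : HeightOneSpectrum (𝓞 L)))
        (CheckOfChi.forall_localComponent_checkOfChi_det hcc (JW_apply_ne_zero (Fp L) L a) χ w hw)
        (CheckOfChi.forall_localComponent_checkOfChi_det hcc (JW_apply_ne_zero (Fp L) L a') χ w hw)
        (Or.inr (localComponent_companion_eq L lam hcc χ lam' hlam hH w))).symm
    · push Not at hsplit
      exact (areIsomorphicRep_localFactor_companion_of_lemD1_4IfAsPrintedI L e₁ dV hdV hdV0 lam hlam a χ a' lam' hlam' v hcc hH hJh hJdet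
        (hflip hJh hJdet v) (nontrivial_localCoinv_of_nontrivial_omegaAtLine L e₁ dV hdV hdV0 lam hlam a χ v)
        (h4if L dV hdV hdV0 e₁ lam hlam a χ a' lam' hlam' hcc hH v hsplit)).symm
  -- glue: Flath over the member-wise isos; the a.e. LINE clause is HYPOTHESIS-FREE for the CM package (★ A-p18 (E2): first sentence of
  -- [Liu2021, Lem. D.1] in-house at every place — MVW IV.4 ★ at the non-split places, the split model ★ at the split ones)
  obtain ⟨Ψ, hΨ⟩ := exists_equiv_rhoVAtLine_of_forall_areIsomorphicRep_localFactor_cm L e₁ dV hdV hdV0 (two_le_of_finTwo_equiv e₁)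
    (toHeckeCharacter L lam) (isUnitary_toHeckeCharacter L lam) ((isOscillatorChar_toHeckeCharacter_iff lam).mpr hlam) a χ
    (borelPlaceMeasure L) (cmFinLocalFamily L e₁ dV hdV hdV0 (lineW L (TW (Fp L) a)) (complexConj_lineW L (TW (Fp L) a)) (lineW_ne_zero L (TW (Fp L) a) (isUnit_det_TW (Fp L) a)) (toHeckeCharacter L lam) ((isOscillatorChar_toHeckeCharacter_iff lam).mpr hlam) (borelPlaceMeasure L))
    (toHeckeCharacter L lam') (isUnitary_toHeckeCharacter L lam') ((isOscillatorChar_toHeckeCharacter_iff lam').mpr hlam') a' χ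
    (borelPlaceMeasure L) hiso
  -- assemble `j′ := Ψ ∘ j`
  refine ⟨lam', hlam', hw', hΦ', LinearMap.intertwiningMap_of_isIntertwiningMap _ _ (Ψ.toLinearMap ∘ₗ j.toLinearMap) ?_, ?_⟩
  · intro k w
    rw [LinearMap.comp_apply, LinearEquiv.coe_toLinearMap, Representation.IntertwiningMap.toLinearMap_apply,
      LinearMap.comp_apply, LinearEquiv.coe_toLinearMap, Representation.IntertwiningMap.toLinearMap_apply, j.isIntertwining _ _ k w]
    exact hΨ _ _
  · intro x y hxy
    change Ψ (j x) = Ψ (j y) at hxy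
    exact hj (Ψ.injective hxy)

end Summit.HodgeConjecture.HodgeConjecture.Cruxes.HLiu418.F0P5CurveThetaCompanionRelabelOfNonsplitIfLetter

end
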